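import Summits.HodgeConjecture.HodgeConjecture.Theorems.H413RallisTransport
import Summits.HodgeConjecture.HodgeConjecture.Theorems.H413ThetaDistNonvanishingOfLift
import Summits.HodgeConjecture.HodgeConjecture.Theorems.H413ThetaPairRepArchFinFactorisation
import HarnessLib

/-!
# FLOOR-0 P4, seat S4b(ii) — THE (26)-ASSEMBLY: `D.dist (charInv χ̃) Φ_f ≠ 0` from the unitary dual pair's theta lift at the line

Cell hodgecm-mathlib (D-0151), FLOOR 0, crux item H413 = stmt-HodgeConjecture-24833; programme P4, line
`Cruxes/H413/Lines/F0_P4AdmissibleOccursInH1.lean` ED. 2, stub S4b; PLAN-F0P4 v2 §5.3 «hR → (A) → (FIN) → ∃ Φ_f, D.dist (charInv χ̃) Φ_f ≠ 0».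
Namespace `Summit.HodgeConjecture.HodgeConjecture.Cruxes.H413.ThetaNonvanishing`.  `--supports stmt-HodgeConjecture-24833 --as helper`.  DEF-FREE.

The `hne` row of ★ `ThetaJunction.exists_holReal_of_transport` asks for ONE `Φ_f` with `D.dist (charInv χ̃) Φ_f ≠ 0`, `D` a theta-distribution
datum of the model over a side whose slot-0 pair datum is the line representation `lineRepOf … 0`.  This file COMPOSES, by name,
★ brick 10 `dist_ne_zero_of_thetaLift_toThetaTop_ne_zero` (distribution ↔ lift), ★ J-R `RallisTransport.kernelDatum_thetaLift_ne_zero_iff_canonical`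
(model lift ↔ the lift of S6's unitary dual pair `cmThetaKernelDatum … hGR₀ …` against the pushed-forward measure and the twisted weight
`(c₂ · charInv χ̃) ∘ a⁻¹`), the weight identification N3 taken POINTWISE as a hypothesis (`hχ'`: the transported automorphic character `χ'`
of `[U(⟨a₀⟩)]` with `χ'([g]) = c₂([e⁻¹ g]) · χ̃([e⁻¹ g])⁻¹`, F0P4-p05's next), and ★ brick 7's head
`thetaLift_charCM_tmul_ne_zero_of_finCoeff_ne_zero` at `F := L⁺, E := L, N := 3, M := 1, J_V := diag(frameD V), J_W := diag(lineVec a₀),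
s := splittingOf hGR₀`:

* `charCM_eq_twist_comp_cosetCongr` — the pointwise `hχ'` IS the function identity `charCM χ' = (c₂ · charInv χ̃) ∘ cosetCongr e⁻¹` of J-R's weight;
* **`dist_ne_zero_of_cmThetaLift_charCM_ne_zero`** — `Θ^{UDP}_{Φarch ℓ ⊗ Φ_f}(charCM χ') ≠ 0 ⟹ D.dist (charInv χ̃) Φ_f ≠ 0`;
* **`dist_ne_zero_of_rallis_of_eigen_of_finCoeff`** — THE ASSEMBLY: Rallis' identity (26) for S6's datum at the line (`hR`), the `∞ ⊔ f` reading
  `hχw` of `χ'`, an `archWeilRep`-eigen-equation for the harmonic vector `D.Φarch ℓ` (`heig`, (A)) and ONE non-zero finite Fourier coefficient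
  (`hfin`, (FIN) = (F2)(F4)(F3′) through ★ brick 8) ⟹ **`D.dist (charInv χ̃) Φ_f ≠ 0`**.
What its user still supplies: S6 itself (`hR`), N3 (`χ'`, `hχ'`, `hχw`), (A) (`heig`), (FIN) (`hfin`), and the measure bookkeeping `hνX`.
HC_CM is proved only modulo the printed citations until rung 0 closes; this file proves nothing about them.

## References
* [Li1992] J.-S. Li, J. reine angew. Math. 428 (1992), p. 178, Thm 2.1 (26)–(27) p. 184.
* [Liu2021] Y. Liu, Camb. J. Math. 9 (2021) = arXiv:2102.11518, proof of Prop. 4.13 (l. 2145), App. D §D.1 Step 3 (l. 5219–5221).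
* [GelbartRogawski1991] S. Gelbart, J. Rogawski, Invent. Math. 105 (1991), §3.1 Remark p. 457 L4–13.  [Weil1964] A. Weil, Acta Math. 111 (1964), n° 41.
-/

set_option autoImplicit false
set_option linter.dupNamespace false

noncomputable section

open _root_.MeasureTheory
open NumberField hiding relNormOneIdeles relNormOneRat probHaarRelNormOneQuot
open NumberField.mixedEmbedding IsDedekindDomain
open scoped Matrix TensorProduct ComplexConjugate NNReal SchwartzMap
open Literature.NumberTheory.Automorphic Literature.NumberTheory.Automorphic.UnitaryGroup Literature.NumberTheory.Weil1964
open Literature.NumberTheory.Weil1964.ThetaKernelDatum Literature.NumberTheory.Li1992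
open Literature.NumberTheory.GelbartRogawski1991 Literature.NumberTheory.GelbartRogawski1991.UnitaryDualPair
open Literature.MeasureTheory.Group Literature.RepresentationTheory.CompactGroups
open HodgeCM HodgeCM.Adelic HodgeCM.PerL34 HodgeCM.Model HodgeCM.Model.ArchSideTerm HodgeCM.Model.SupplyResidual
open HodgeCM.Model.ThetaAdelicSide HodgeCM.Model.HypCensus
open HodgeCM.Model.SupplyResidual.WeilPairData (charInv)
open Summit.HodgeConjecture.HodgeConjecture.Cruxes.H413.RallisTransport

namespace Summit.HodgeConjecture.HodgeConjecture.Cruxes.H413.ThetaNonvanishing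

variable {L : CMField} {ι₁ : L →+* ℂ} (V : HermSpace3 L ι₁) (S : StubTree.SeesawDatum L)
variable
  (hGR : (cmSplittingDatum (L : Type) finProdFinEquiv (frameD V) (frameD_real V) (frameD_ne V) (dW S) (dW_real S) (dW_ne S)).CompatibleSplitting)
  (hGR₀ : (cmSplittingDatum (L : Type) (e₁) (frameD V) (frameD_real V) (frameD_ne V) (lineVec (L : Type) (dW S 0))
    (fun _ => dW_real S 0) (fun _ => dW_ne S 0)).CompatibleSplitting)
  (hGR₁ : (cmSplittingDatum (L : Type) (e₁) (frameD V) (frameD_real V) (frameD_ne V) (lineVec (L : Type) (dW S 1))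
    (fun _ => dW_real S 1) (fun _ => dW_ne S 1)).CompatibleSplitting)
  (hGR₂ : (cmSplittingDatum (L : Type) (e₁) (frameD V) (frameD_real V) (frameD_ne V) (lineVec (L : Type) (dW' S 0))
    (fun _ => dW'_real S 0) (fun _ => dW'_ne S 0)).CompatibleSplitting)
  (hGR₃ : (cmSplittingDatum (L : Type) (e₁) (frameD V) (frameD_real V) (frameD_ne V) (lineVec (L : Type) (dW' S 1))
    (fun _ => dW'_real S 1) (fun _ => dW'_ne S 1)).CompatibleSplitting)
  (η₀ η₁ η₂ η₃ : CMAdelic (L : Type) (frameD V) × CMAdelicOne (L : Type) →* ℂˣ)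
  (hV : IsAnisotropic L V.Hm)
  {cx : SeesawCtx L} {S' : ThetaAdelicSide V cx} (D : S'.ThetaDistDatum hV 0)
  (hPω : (S'.P 0).ω = lineRepOf V S hGR hGR₀ hGR₁ hGR₂ hGR₃ η₀ η₁ η₂ η₃ 0) (hPΓ : (S'.P 0).ΓU = regimeRat L V.Hm)
  (hρ : HasThetaMajorants fun
    (p : CMAdelic (L : Type) (frameD V) × CMAdelic (L : Type) (lineVec (L : Type) (dW S 0)))
    (Φ : piSchwartzBruhat (↥(maximalRealSubfield L)) (Fin 3)) =>
      cmPairRep (L : Type) e₁ (frameD V) (frameD_real V) (frameD_ne V) (lineVec (L : Type) (dW S 0))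
        (fun _ => dW_real S 0) (fun _ => dW_ne S 0) hGR₀ p Φ)
  (SK : Set (piSchwartzBruhat (↥(maximalRealSubfield L)) (Fin 3)))
  (hSK : ∀ (h : CMAdelic (L : Type) (lineVec (L : Type) (dW S 0))) (Φ : piSchwartzBruhat (↥(maximalRealSubfield L)) (Fin 3)),
    Φ ∈ SK → cmPairRep (L : Type) e₁ (frameD V) (frameD_real V) (frameD_ne V) (lineVec (L : Type) (dW S 0))
      (fun _ => dW_real S 0) (fun _ => dW_ne S 0) hGR₀ (1, h) Φ ∈ SK)

variable [MeasurableSpace (CMAdelic (L : Type) (lineVec (L : Type) (dW S 0)) ⧸ CMRat (L : Type) (lineVec (L : Type) (dW S 0)))]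
  [BorelSpace (CMAdelic (L : Type) (lineVec (L : Type) (dW S 0)) ⧸ CMRat (L : Type) (lineVec (L : Type) (dW S 0)))]
  [CompactSpace (CMAdelic (L : Type) (frameD V) ⧸ CMRat (L : Type) (frameD V))]
  [CompactSpace (CMAdelic (L : Type) (lineVec (L : Type) (dW S 0)) ⧸ CMRat (L : Type) (lineVec (L : Type) (dW S 0)))]
  [(CMRat (L : Type) (lineVec (L : Type) (dW S 0))).Normal]

variable
  (c₂ : C(↥(relNormOneIdeles (↥(maximalRealSubfield L)) L) ⧸ relNormOneRat (↥(maximalRealSubfield L)) L, ℂ))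
  (hc₂ : ∀ t : ↥(relNormOneIdeles (↥(maximalRealSubfield L)) L),
    c₂ (QuotientGroup.mk t) =
      (((η₀ (1, (cmAdelicOneEquivRelNormOne (L : Type)).symm t) *
          cmLineChar₀ (L : Type) finProdFinEquiv e₁ (frameD V) (frameD_real V) (frameD_ne V) (dW S) (dW_real S) (dW_ne S)
            hGR hGR₀ hGR₁ (1, cmLineTorusEquiv (L : Type) (dW S 0) (dW_ne S 0) t))⁻¹ : ℂˣ) : ℂ))
  (χ : PontryaginDual (↥(relNormOneIdeles (↥(maximalRealSubfield L)) L) ⧸ relNormOneRat (↥(maximalRealSubfield L)) L))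
  (χ' : PontryaginDual (CMAdelic (L : Type) (lineVec (L : Type) (dW S 0)) ⧸ CMRat (L : Type) (lineVec (L : Type) (dW S 0))))
  (hχ' : ∀ g : CMAdelic (L : Type) (lineVec (L : Type) (dW S 0)),
    ((χ' (QuotientGroup.mk g) : Circle) : ℂ) =
      c₂ (QuotientGroup.mk ((cmLineTorusEquiv (L : Type) (dW S 0) (dW_ne S 0)).symm g)) *
        charInv χ (QuotientGroup.mk ((cmLineTorusEquiv (L : Type) (dW S 0) (dW_ne S 0)).symm g)))

/-! ## §1 The weight: `charCM χ' = (c₂ · charInv χ̃) ∘ cosetCongr e⁻¹` -/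

omit [MeasurableSpace (CMAdelic (L : Type) (lineVec (L : Type) (dW S 0)) ⧸ CMRat (L : Type) (lineVec (L : Type) (dW S 0)))]
  [BorelSpace (CMAdelic (L : Type) (lineVec (L : Type) (dW S 0)) ⧸ CMRat (L : Type) (lineVec (L : Type) (dW S 0)))]
  [CompactSpace (CMAdelic (L : Type) (lineVec (L : Type) (dW S 0)) ⧸ CMRat (L : Type) (lineVec (L : Type) (dW S 0)))] in
include hχ' in
/-- the pointwise identification `χ'([g]) = c₂([e⁻¹ g]) · χ̃([e⁻¹ g])⁻¹` IS the identity of weight functions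
`charCM χ' = (c₂ · charInv χ̃) ∘ cosetCongr e⁻¹` appearing in ★ `kernelDatum_thetaLift_ne_zero_iff_canonical`.
[cite: Li1992, p. 178] [cite: Liu2021, proof of Prop. 4.13 (l. 2145)] -/
theorem charCM_eq_twist_comp_cosetCongr :
    charCM χ' =
      (c₂ * charInv χ).comp
        ⟨cosetCongr (cmLineTorusEquiv (L : Type) (dW S 0) (dW_ne S 0)).symm (CMRat (L : Type) (lineVec (L : Type) (dW S 0)))
            (relNormOneRat (↥(maximalRealSubfield L)) L)
            (forall_symm_mem_iff _ _ _ (cmLineTorusEquiv_mem_CMRat_iff (L : Type) (dW S 0) (dW_ne S 0))),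
          continuous_cosetCongr _ _ _ (forall_symm_mem_iff _ _ _ (cmLineTorusEquiv_mem_CMRat_iff (L : Type) (dW S 0) (dW_ne S 0)))
            (continuous_cmLineTorusEquiv_symm (L : Type) (dW S 0) (dW_ne S 0))⟩ := by
  refine ContinuousMap.ext fun q => ?_
  induction q using QuotientGroup.induction_on with
  | H g =>
    rw [charCM_apply, hχ']
    rfl

/-! ## §2 From the unitary dual pair's lift to the distribution -/

include hPω hPΓ hc₂ hχ' in
/-- **`Θ^{UDP}_{Φarch ℓ ⊗ Φ_f}(charCM χ') ≠ 0 ⟹ D.dist (charInv χ̃) Φ_f ≠ 0`** — ★ J-R canonical transport read backwards, then ★ brick 10.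
[cite: Li1992, p. 178] [cite: GelbartRogawski1991, §3.1 Remark p. 457 L4–13] [cite: Liu2021, proof of Prop. 4.13 (l. 2145)] -/
theorem dist_ne_zero_of_cmThetaLift_charCM_ne_zero [hΓc : CompactSpace (↥(regimeSubgroup L V.Hm) ⧸ (S'.P 0).ΓU)]
    (Φf : FinSB (↥(maximalRealSubfield L)) (Fin 3)) (ℓ : Module.Dual ℂ (Fin 2 → ℂ))
    (h : (cmThetaKernelDatum (L : Type) e₁ (frameD V) (frameD_real V) (frameD_ne V) (lineVec (L : Type) (dW S 0))
            (fun _ => dW_real S 0) (fun _ => dW_ne S 0) hGR₀ hρ SK hSK).thetaLift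
          ((probHaarRelNormOneQuot (↥(maximalRealSubfield L)) L).map
            (cosetCongr (cmLineTorusEquiv (L : Type) (dW S 0) (dW_ne S 0))
              (relNormOneRat (↥(maximalRealSubfield L)) L) (CMRat (L : Type) (lineVec (L : Type) (dW S 0)))
              (cmLineTorusEquiv_mem_CMRat_iff (L : Type) (dW S 0) (dW_ne S 0))))
          (piSchwartzBruhatEquiv (↥(maximalRealSubfield L)) (Fin 3) (D.Φarch ℓ ⊗ₜ[ℂ] Φf)) (charCM χ') ≠ 0) :
    D.dist (charInv χ) Φf ≠ 0 := by
  refine dist_ne_zero_of_thetaLift_toThetaTop_ne_zero D (charInv χ) Φf (ℓ := ℓ) ?_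
  refine (@kernelDatum_thetaLift_ne_zero_iff_canonical L ι₁ V S hGR hGR₀ hGR₁ hGR₂ hGR₃ η₀ η₁ η₂ η₃ (S'.P 0) hPω hPΓ hρ SK hSK
    _ _ _ _ hΓc (probHaarRelNormOneQuot (↥(maximalRealSubfield L)) L) _ hV c₂ hc₂
    (piSchwartzBruhatEquiv (↥(maximalRealSubfield L)) (Fin 3) (D.Φarch ℓ ⊗ₜ[ℂ] Φf)) (charInv χ)).2 ?_
  rw [← charCM_eq_twist_comp_cosetCongr S c₂ χ χ' hχ']
  exact h


/-! ## §3 THE ASSEMBLY: Rallis (26) + (A) + (FIN) ⟹ `D.dist (charInv χ̃) Φ_f ≠ 0` -/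

section Assembly

variable
  [MeasurableSpace (AdeleRing (𝓞 ↥(maximalRealSubfield L)) ↥(maximalRealSubfield L))]
  [BorelSpace (AdeleRing (𝓞 ↥(maximalRealSubfield L)) ↥(maximalRealSubfield L))]
  [MeasurableSpace (FiniteAdeleRing (𝓞 ↥(maximalRealSubfield L)) ↥(maximalRealSubfield L))]
  [BorelSpace (FiniteAdeleRing (𝓞 ↥(maximalRealSubfield L)) ↥(maximalRealSubfield L))]
  {νX : Measure (Fin 3 → AdeleRing (𝓞 ↥(maximalRealSubfield L)) ↥(maximalRealSubfield L))}
  {μE : Measure (Fin 3 → mixedSpace ↥(maximalRealSubfield L))}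
  {μfX : Measure (Fin 3 → FiniteAdeleRing (𝓞 ↥(maximalRealSubfield L)) ↥(maximalRealSubfield L))} {cX : ℝ≥0}
  [MeasurableSpace (CMAdelic (L : Type) (lineVec (L : Type) (dW S 0)))] [BorelSpace (CMAdelic (L : Type) (lineVec (L : Type) (dW S 0)))]
  [MeasurableSpace (UnitaryGroup.arch (↥(maximalRealSubfield L)) (L : Type) (IsCMField.complexConj L) 1 (Matrix.diagonal (lineVec (L : Type) (dW S 0))))]
  [BorelSpace (UnitaryGroup.arch (↥(maximalRealSubfield L)) (L : Type) (IsCMField.complexConj L) 1 (Matrix.diagonal (lineVec (L : Type) (dW S 0))))]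
  [MeasurableSpace (UnitaryGroup.finAdelic (↥(maximalRealSubfield L)) (L : Type) (IsCMField.complexConj L) 1 (Matrix.diagonal (lineVec (L : Type) (dW S 0))))]
  [BorelSpace (UnitaryGroup.finAdelic (↥(maximalRealSubfield L)) (L : Type) (IsCMField.complexConj L) 1 (Matrix.diagonal (lineVec (L : Type) (dW S 0))))]
  (dh : Measure (CMAdelic (L : Type) (lineVec (L : Type) (dW S 0))))
  (μa : Measure (UnitaryGroup.arch (↥(maximalRealSubfield L)) (L : Type) (IsCMField.complexConj L) 1 (Matrix.diagonal (lineVec (L : Type) (dW S 0)))))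
  (μf : Measure (UnitaryGroup.finAdelic (↥(maximalRealSubfield L)) (L : Type) (IsCMField.complexConj L) 1 (Matrix.diagonal (lineVec (L : Type) (dW S 0)))))
  [dh.IsHaarMeasure] [μa.IsHaarMeasure] [μf.IsHaarMeasure] [IsFiniteMeasure μa] [SFinite μE] [SFinite μfX]
  [MeasurableSpace (CMAdelic (L : Type) (frameD V) ⧸ CMRat (L : Type) (frameD V))]
  (ν : Measure (CMAdelic (L : Type) (frameD V) ⧸ CMRat (L : Type) (frameD V)))
  {s : UnitaryGroup.adelicPair (↥(maximalRealSubfield L)) (L : Type) (IsCMField.complexConj L) 3 1 (Matrix.diagonal (frameD V))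
      (Matrix.diagonal (lineVec (L : Type) (dW S 0))) →*
    adelicMpCont (↥(maximalRealSubfield L)) (Fin 3)
      (adelicGram (↥(maximalRealSubfield L)) e₁ (realDiagonal (L : Type) (frameD V) (frameD_real V))
        (realDiagonal (L : Type) (lineVec (L : Type) (dW S 0)) (fun _ => dW_real S 0)))}
  (hs : (cmSplittingDatum (L : Type) e₁ (frameD V) (frameD_real V) (frameD_ne V) (lineVec (L : Type) (dW S 0))
    (fun _ => dW_real S 0) (fun _ => dW_ne S 0)).IsCompatible s)
  (hs_def : s = splittingOf (↥(maximalRealSubfield L)) (L : Type) (IsCMField.complexConj L) 3 1 e₁ (Matrix.diagonal (frameD V))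
      (Matrix.diagonal (lineVec (L : Type) (dW S 0))) (complexConj_imagUnit (L : Type)) (imagUnit_ne_zero (L : Type))
      (imagUnit_mul_self (L : Type)) (realDiagonal_isSymm (L : Type) (frameD V) (frameD_real V))
      (realDiagonal_isSymm (L : Type) (lineVec (L : Type) (dW S 0)) (fun _ => dW_real S 0))
      (isUnit_det_realDiagonal (L : Type) (frameD V) (frameD_real V) (frameD_ne V))
      (isUnit_det_realDiagonal (L : Type) (lineVec (L : Type) (dW S 0)) (fun _ => dW_real S 0) (fun _ => dW_ne S 0))
      (realDiagonal_map (L : Type) (frameD V) (frameD_real V)).symm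
      (realDiagonal_map (L : Type) (lineVec (L : Type) (dW S 0)) (fun _ => dW_real S 0)).symm hGR₀)

include hPω hPΓ hc₂ hχ' hs_def μa in
/-- **THE (26)-ASSEMBLY — `D.dist (charInv χ̃) Φ_f ≠ 0` FROM RALLIS' IDENTITY FOR S6's DATUM AT THE LINE, AN ARCHIMEDEAN EIGEN-EQUATION OF THE
HARMONIC VECTOR, AND ONE NON-ZERO FINITE FOURIER COEFFICIENT.**  Hypotheses, by row of PLAN-F0P4 v2 §3: `hνX`∕`hcX` (the `L²(X(𝔸))` pairing of
(26) is `c_X · (μ_∞ ⊗ μ_{X,f})` through `piAdeleSplit` — OUR CHOICE of measures, S6 quantifies over all), `hR` = S6 = [Li1992, Thm 2.1 (26)] for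
`cmThetaKernelDatum … hGR₀` against the pushed-forward probability Haar measure of `[U(1)]` (★ J-R), `χ'`∕`hχ'` = N3 (the transported twisted
character, F0P4-p05), `hχw` its `∞ ⊔ f` reading (`χ'_∞ = χinf` unitary, finite weight `wfin`), `heig` = (A) for `Φ_∞ := D.Φarch ℓ` under
`archWeilRep … s` (F0P4-p07 ★ `H413ArchTorusCentreSwap` + central type), `hΦ` = `⟨Φ_∞, Φ_∞⟩_{μ_∞} ≠ 0`, `hfin` = (FIN) (F0P4-p07 (F2) + ★ brick 8
+ F0P4-p08 (F4) + (F3′)).  Conclusion: the `hne` row of ★ `ThetaJunction.exists_holReal_of_transport` for this `Φ_f`.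
[cite: Li1992, p. 178 and Thm 2.1 (26)–(27) p. 184] [cite: GelbartRogawski1991, §3.1 Remark p. 457 L4–13] [cite: Liu2021, proof of Prop. 4.13 (l. 2145); App. D §D.1 Step 3 (l. 5219–5221)] -/
theorem dist_ne_zero_of_rallis_of_eigen_of_finCoeff [hΓc : CompactSpace (↥(regimeSubgroup L V.Hm) ⧸ (S'.P 0).ΓU)]
    (hνX : νX = cX • (μE.prod μfX).map (piAdeleSplit (↥(maximalRealSubfield L)) (Fin 3))) (hcX : cX ≠ 0)
    [IsFiniteMeasure ((probHaarRelNormOneQuot (↥(maximalRealSubfield L)) L).map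
        (cosetCongr (cmLineTorusEquiv (L : Type) (dW S 0) (dW_ne S 0)) (relNormOneRat (↥(maximalRealSubfield L)) L)
          (CMRat (L : Type) (lineVec (L : Type) (dW S 0))) (cmLineTorusEquiv_mem_CMRat_iff (L : Type) (dW S 0) (dW_ne S 0))))]
    [((probHaarRelNormOneQuot (↥(maximalRealSubfield L)) L).map
        (cosetCongr (cmLineTorusEquiv (L : Type) (dW S 0) (dW_ne S 0)) (relNormOneRat (↥(maximalRealSubfield L)) L)
          (CMRat (L : Type) (lineVec (L : Type) (dW S 0))) (cmLineTorusEquiv_mem_CMRat_iff (L : Type) (dW S 0) (dW_ne S 0)))).IsOpenPosMeasure]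
    (hR : (cmThetaKernelDatum (L : Type) e₁ (frameD V) (frameD_real V) (frameD_ne V) (lineVec (L : Type) (dW S 0))
          (fun _ => dW_real S 0) (fun _ => dW_ne S 0) hGR₀ hρ SK hSK).RallisInnerProductIdentity
        (schwartzPairing (↥(maximalRealSubfield L)) (Fin 3) νX) dh
        ((probHaarRelNormOneQuot (↥(maximalRealSubfield L)) L).map
          (cosetCongr (cmLineTorusEquiv (L : Type) (dW S 0) (dW_ne S 0)) (relNormOneRat (↥(maximalRealSubfield L)) L)
            (CMRat (L : Type) (lineVec (L : Type) (dW S 0))) (cmLineTorusEquiv_mem_CMRat_iff (L : Type) (dW S 0) (dW_ne S 0))))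
        ν)
    {χinf : UnitaryGroup.arch (↥(maximalRealSubfield L)) (L : Type) (IsCMField.complexConj L) 1 (Matrix.diagonal (lineVec (L : Type) (dW S 0))) → ℂ}
    (hχu : ∀ a, χinf a * conj (χinf a) = 1)
    {wfin : UnitaryGroup.finAdelic (↥(maximalRealSubfield L)) (L : Type) (IsCMField.complexConj L) 1 (Matrix.diagonal (lineVec (L : Type) (dW S 0))) → ℂ}
    (hχw : ∀ h : CMAdelic (L : Type) (lineVec (L : Type) (dW S 0)), conj ((χ' (QuotientGroup.mk h) : Circle) : ℂ) =
      conj (χinf (UnitaryGroup.archPart (↥(maximalRealSubfield L)) (L : Type) (IsCMField.complexConj L) 1 _ h)) *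
        wfin (UnitaryGroup.finPart (↥(maximalRealSubfield L)) (L : Type) (IsCMField.complexConj L) 1 _ h))
    (ℓ : Module.Dual ℂ (Fin 2 → ℂ))
    (heig : ∀ a, archWeilRep (↥(maximalRealSubfield L)) (L : Type) (IsCMField.complexConj L) 3 1 (Matrix.diagonal (frameD V))
        (Matrix.diagonal (lineVec (L : Type) (dW S 0))) (complexConj_imagUnit (L : Type)) (imagUnit_ne_zero (L : Type))
        (imagUnit_mul_self (L : Type)) (realDiagonal_isSymm (L : Type) (frameD V) (frameD_real V))
        (realDiagonal_isSymm (L : Type) (lineVec (L : Type) (dW S 0)) (fun _ => dW_real S 0))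
        (isUnit_det_realDiagonal (L : Type) (frameD V) (frameD_real V) (frameD_ne V))
        (isUnit_det_realDiagonal (L : Type) (lineVec (L : Type) (dW S 0)) (fun _ => dW_real S 0) (fun _ => dW_ne S 0))
        (realDiagonal_map (L : Type) (frameD V) (frameD_real V)).symm
        (realDiagonal_map (L : Type) (lineVec (L : Type) (dW S 0)) (fun _ => dW_real S 0)).symm e₁ s
        (proj_apply_eq_toSp (↥(maximalRealSubfield L)) (L : Type) (IsCMField.complexConj L) 3 1 e₁ _ _ _ _ _ _ _ _ _ _ _ hs) (1, a)
        (D.Φarch ℓ) = χinf a • D.Φarch ℓ)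
    (hΦ : ∫ x, D.Φarch ℓ x * conj (D.Φarch ℓ x) ∂μE ≠ 0)
    {Φf : FinSB (↥(maximalRealSubfield L)) (Fin 3)}
    (hfin : (∫ b, (∫ y, ((finSBReindex (↥(maximalRealSubfield L)) e₁
            (WeilCoinv.finPairRep (↥(maximalRealSubfield L)) (L : Type) (IsCMField.complexConj L) 3 1 e₁ _ _ _ _ _ _ _ _ _ _ _ hs (1, b)
              ((finSBReindex (↥(maximalRealSubfield L)) e₁).symm Φf)) : FinSB (↥(maximalRealSubfield L)) (Fin 3)) :
              (Fin 3 → FiniteAdeleRing (𝓞 ↥(maximalRealSubfield L)) ↥(maximalRealSubfield L)) → ℂ) y *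
          conj ((Φf : (Fin 3 → FiniteAdeleRing (𝓞 ↥(maximalRealSubfield L)) ↥(maximalRealSubfield L)) → ℂ) y) ∂μfX) * wfin b ∂μf) ≠ 0) :
    D.dist (charInv χ) Φf ≠ 0 := by
  subst hs_def
  refine dist_ne_zero_of_cmThetaLift_charCM_ne_zero V S hGR hGR₀ hGR₁ hGR₂ hGR₃ η₀ η₁ η₂ η₃ hV D hPω hPΓ hρ SK hSK c₂ hc₂ χ χ' hχ' (hΓc := hΓc) Φf ℓ ?_
  exact (thetaLift_charCM_tmul_ne_zero_of_finCoeff_ne_zero (↥(maximalRealSubfield L)) (L : Type) (IsCMField.complexConj L) 3 1 e₁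
    (Matrix.diagonal (frameD V)) (Matrix.diagonal (lineVec (L : Type) (dW S 0))) (complexConj_imagUnit (L : Type))
    (imagUnit_ne_zero (L : Type)) (imagUnit_mul_self (L : Type)) (realDiagonal_isSymm (L : Type) (frameD V) (frameD_real V))
    (realDiagonal_isSymm (L : Type) (lineVec (L : Type) (dW S 0)) (fun _ => dW_real S 0))
    (isUnit_det_realDiagonal (L : Type) (frameD V) (frameD_real V) (frameD_ne V))
    (isUnit_det_realDiagonal (L : Type) (lineVec (L : Type) (dW S 0)) (fun _ => dW_real S 0) (fun _ => dW_ne S 0))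
    (realDiagonal_map (L : Type) (frameD V) (frameD_real V)).symm
    (realDiagonal_map (L : Type) (lineVec (L : Type) (dW S 0)) (fun _ => dW_real S 0)).symm hs dh μa μf hρ SK hSK _ ν
    hνX hcX hR χ' hχu hχw heig hΦ hfin).1

end Assembly

end Summit.HodgeConjecture.HodgeConjecture.Cruxes.H413.ThetaNonvanishing

end
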